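import Literature.MathematicalPhysics.QuantumLattice.GibbsStateSecondMoments
import HarnessLib

/-!
# Crux `TwSeededEnsembleEquivalenceR` (stmt-HubbardSuperconductivity-15581), line `cold-floor-collapse` (slug `Sketch`),
# skeleton v8 (block two-phase pinning) — registered helper stub `stub_twoPhaseGapArithmetic` (S7i-arith) + the other abstract lemmas of the two-phase budget

Support file (`--supports stmt-HubbardSuperconductivity-15581`; sorry-free; no definition).
Pure real arithmetic (and one positivity fact about Gibbs states) behind the lead's two-phase budget S7i `stub_trialStateBudget`:
block-count tuning, gap arithmetic (registered as `stub_twoPhaseGapArithmetic`), block-density brackets, mean arithmetic, remainder-number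
bounds, and the two `eventually in L` absorptions.
-/

set_option linter.dupNamespace false

namespace Summit.HubbardSuperconductivity.HubbardSuperconductivity.Theorems.TwSeededEnsembleEquivalenceR.ColdFloorLine

open Matrix Filter Topology Finset Literature.MathematicalPhysics.QuantumLattice
open Literature.Barriers.HubbardSuperconductivity Literature.Probability.LatticeModels
open scoped ComplexOrder Matrix.Norms.L2Operator

noncomputable section

/-! ### Abstract real arithmetic of the two-phase budget -/

/-- **Block-count tuning (discrete intermediate value for an affine interpolation).** For `nA ≤ nB` and any target `T`
there is `a ≤ K` with `|a·nA + (K − a)·nB − T| ≤ (nB − nA) + (K nA − T)₊ + (T − K nB)₊`. [folklore] -/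
theorem tsb_tuning (K : ℕ) {nA nB : ℝ} (T : ℝ) (hAB : nA ≤ nB) :
    ∃ a : ℕ, a ≤ K ∧ |(a : ℝ) * nA + ((K : ℝ) - a) * nB - T| ≤
      (nB - nA) + max ((K : ℝ) * nA - T) 0 + max (T - (K : ℝ) * nB) 0 := by
  have hm1 : 0 ≤ max ((K : ℝ) * nA - T) 0 := le_max_right _ _
  have hm2 : 0 ≤ max (T - (K : ℝ) * nB) 0 := le_max_right _ _
  have hd0 : 0 ≤ nB - nA := sub_nonneg.mpr hAB
  by_cases h1 : T ≤ (K : ℝ) * nA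
  · refine ⟨K, le_rfl, ?_⟩
    have e : (K : ℝ) * nA + ((K : ℝ) - K) * nB - T = (K : ℝ) * nA - T := by ring
    rw [e, abs_of_nonneg (by linarith)]
    have := le_max_left ((K : ℝ) * nA - T) 0
    linarith
  by_cases h2 : (K : ℝ) * nB ≤ T
  · refine ⟨0, Nat.zero_le _, ?_⟩
    have e : ((0 : ℕ) : ℝ) * nA + ((K : ℝ) - (0 : ℕ)) * nB - T = -(T - (K : ℝ) * nB) := by push_cast; ring
    rw [e, abs_neg, abs_of_nonneg (by linarith)]
    have := le_max_left (T - (K : ℝ) * nB) 0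
    linarith
  have h1 : (K : ℝ) * nA < T := lt_of_not_ge h1
  have h2 : T < (K : ℝ) * nB := lt_of_not_ge h2
  have hlt : nA < nB := by
    refine lt_of_not_ge fun h => ?_
    have : (K : ℝ) * nB ≤ (K : ℝ) * nA := mul_le_mul_of_nonneg_left h (Nat.cast_nonneg K)
    linarith
  have hd : 0 < nB - nA := sub_pos.mpr hlt
  set x : ℝ := ((K : ℝ) * nB - T) / (nB - nA) with hx
  have hx0 : 0 ≤ x := div_nonneg (by linarith) hd.le
  have hxK : x < K := by rw [hx, div_lt_iff₀ hd]; nlinarith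
  have hxe : x * (nB - nA) = (K : ℝ) * nB - T := by rw [hx]; field_simp
  refine ⟨⌊x⌋₊, ((Nat.floor_lt hx0).mpr hxK).le, ?_⟩
  have hfl : (⌊x⌋₊ : ℝ) ≤ x := Nat.floor_le hx0
  have hfl2 : x < (⌊x⌋₊ : ℝ) + 1 := Nat.lt_floor_add_one x
  have key : (⌊x⌋₊ : ℝ) * nA + ((K : ℝ) - ⌊x⌋₊) * nB - T = (x - ⌊x⌋₊) * (nB - nA) := by linear_combination -hxe
  rw [key, abs_of_nonneg (mul_nonneg (by linarith) hd.le)]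
  have : (x - ⌊x⌋₊) * (nB - nA) ≤ 1 * (nB - nA) := mul_le_mul_of_nonneg_right (by linarith) hd.le
  linarith

/-- **Gap arithmetic.** The Peierls–Bogoliubov gap of the two-phase trial state in terms of the limit pressure `φ = q(·,h₀)` at the
five points `μs, μs ∓ σ, μs ∓ 2σ`: the block pressures enter through their `r`-accuracy and two chords, the seeded pressure through
its `κ`-accuracy, and what is left are two second differences of the `2`-Lipschitz `φ` over steps `σ` (`≤ 4σ` each), the
`3r`, `κ`, cut `C₁/M` and boundary `O(LM)` terms. [folklore] -/
theorem tsb_gap_arith {β L M Kr ar σ r κ C₁ h₀ g μs φs φm1 φm2 φp1 φp2 ZK ZKt ZA ZAm ZB ZBp nA nB XA XB E R Rb : ℝ}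
    (hβ : 0 < β) (hL : 0 < L) (hM : 0 < M) (har0 : 0 ≤ ar) (harK : ar ≤ Kr) (hKM : Kr * M ^ 2 ≤ L ^ 2)
    (hLK : L ^ 2 - Kr * M ^ 2 ≤ 2 * L * M) (hr : 0 ≤ r)
    (h1 : |φs - φm1| ≤ 2 * σ) (h2 : |φm1 - φm2| ≤ 2 * σ) (h3 : |φp1 - φs| ≤ 2 * σ) (h4 : |φp2 - φp1| ≤ 2 * σ)
    (hZK : ZK / (β * L ^ 2) - (φs - h₀ ^ 2 / g) ≤ κ)
    (hZA : |ZA / (β * M ^ 2) - φm1| ≤ r) (hZAm : |ZAm / (β * M ^ 2) - φm2| ≤ r)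
    (hZB : |ZB / (β * M ^ 2) - φp1| ≤ r) (hZBp : |ZBp / (β * M ^ 2) - φp2| ≤ r)
    (hcA : ZA - ZAm ≤ σ * (β * nA)) (hcB : σ * (β * nB) ≤ ZBp - ZB)
    (hZKt : ZKt = ar * ZA + (Kr - ar) * ZB + R) (hR : |R| ≤ Rb) (hXA : XA = ar * nA) (hXB : XB = (Kr - ar) * nB)
    (hE : E ≤ h₀ ^ 2 / g * L ^ 2 + (μs - σ - μs) * XA + (μs + σ - μs) * XB + C₁ * (L ^ 2 / M + L * M)) :
    ZK - ZKt + β * E ≤ β * (L ^ 2 * (4 * σ + κ + 3 * r + C₁ / M) + L * M * (2 * |φs| + C₁)) + Rb := by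
  have hKa : 0 ≤ Kr - ar := by linarith
  have hσ : 0 ≤ σ := by linarith [abs_nonneg (φs - φm1)]
  have hβL : 0 < β * L ^ 2 := by positivity
  have hβM : 0 < β * M ^ 2 := by positivity
  -- one-sided forms of the accuracies
  have hZK' : ZK ≤ β * L ^ 2 * (φs - h₀ ^ 2 / g + κ) := by
    have := (div_le_iff₀ hβL).mp (show ZK / (β * L ^ 2) ≤ φs - h₀ ^ 2 / g + κ by linarith)
    linarith
  have hZA' : β * M ^ 2 * (φm1 - r) ≤ ZA := by
    have h := (abs_le.mp hZA).1
    have := (le_div_iff₀ hβM).mp (show φm1 - r ≤ ZA / (β * M ^ 2) by linarith)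
    linarith
  have hZAm' : ZAm ≤ β * M ^ 2 * (φm2 + r) := by
    have h := (abs_le.mp hZAm).2
    have := (div_le_iff₀ hβM).mp (show ZAm / (β * M ^ 2) ≤ φm2 + r by linarith)
    linarith
  have hZB' : β * M ^ 2 * (φp1 - r) ≤ ZB := by
    have h := (abs_le.mp hZB).1
    have := (le_div_iff₀ hβM).mp (show φp1 - r ≤ ZB / (β * M ^ 2) by linarith)
    linarith
  have hZBp' : ZBp ≤ β * M ^ 2 * (φp2 + r) := by
    have h := (abs_le.mp hZBp).2
    have := (div_le_iff₀ hβM).mp (show ZBp / (β * M ^ 2) ≤ φp2 + r by linarith)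
    linarith
  -- products with the non-negative weights
  have pA1 : ar * (β * M ^ 2 * (φm1 - r)) ≤ ar * ZA := mul_le_mul_of_nonneg_left hZA' har0
  have pA2 : ar * ZAm ≤ ar * (β * M ^ 2 * (φm2 + r)) := mul_le_mul_of_nonneg_left hZAm' har0
  have pB1 : (Kr - ar) * (β * M ^ 2 * (φp1 - r)) ≤ (Kr - ar) * ZB := mul_le_mul_of_nonneg_left hZB' hKa
  have pB2 : (Kr - ar) * ZBp ≤ (Kr - ar) * (β * M ^ 2 * (φp2 + r)) := mul_le_mul_of_nonneg_left hZBp' hKa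
  have eA : ar * (ZA - ZAm) ≤ ar * (σ * (β * nA)) := mul_le_mul_of_nonneg_left hcA har0
  have eB : (Kr - ar) * (σ * (β * nB)) ≤ (Kr - ar) * (ZBp - ZB) := mul_le_mul_of_nonneg_left hcB hKa
  -- second differences of `φ`
  have sA : φs - 2 * φm1 + φm2 ≤ 4 * σ := by
    have := (abs_le.mp h1).2; have := (abs_le.mp h2).1; linarith
  have sB : φs - 2 * φp1 + φp2 ≤ 4 * σ := by
    have := (abs_le.mp h3).1; have := (abs_le.mp h4).2; linarith
  have qA : ar * (β * M ^ 2) * (φs - 2 * φm1 + φm2) ≤ ar * (β * M ^ 2) * (4 * σ) :=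
    mul_le_mul_of_nonneg_left sA (by positivity)
  have qB : (Kr - ar) * (β * M ^ 2) * (φs - 2 * φp1 + φp2) ≤ (Kr - ar) * (β * M ^ 2) * (4 * σ) :=
    mul_le_mul_of_nonneg_left sB (mul_nonneg hKa hβM.le)
  -- the slack `L² − K M²` against `|φs|`
  have hslack : (L ^ 2 - Kr * M ^ 2) * φs ≤ 2 * L * M * |φs| := by
    have h0 : 0 ≤ L ^ 2 - Kr * M ^ 2 := by linarith
    calc (L ^ 2 - Kr * M ^ 2) * φs ≤ (L ^ 2 - Kr * M ^ 2) * |φs| := mul_le_mul_of_nonneg_left (le_abs_self _) h0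
      _ ≤ 2 * L * M * |φs| := mul_le_mul_of_nonneg_right hLK (abs_nonneg _)
  have hslack2 : Kr * M ^ 2 * (4 * σ + 3 * r) ≤ L ^ 2 * (4 * σ + 3 * r) :=
    mul_le_mul_of_nonneg_right hKM (by linarith)
  have hRle : -R ≤ Rb := by have := (abs_le.mp hR).1; linarith
  subst hZKt hXA hXB
  have hE' : β * E ≤ β * (h₀ ^ 2 / g * L ^ 2) - σ * β * (ar * nA) + σ * β * ((Kr - ar) * nB) +
      β * L ^ 2 * (C₁ / M) + β * L * M * C₁ := by
    have h := mul_le_mul_of_nonneg_left hE hβ.le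
    have hcut : β * (C₁ * (L ^ 2 / M + L * M)) = β * L ^ 2 * (C₁ / M) + β * L * M * C₁ := by
      field_simp
    have e : β * (h₀ ^ 2 / g * L ^ 2 + (μs - σ - μs) * (ar * nA) + (μs + σ - μs) * ((Kr - ar) * nB) +
        C₁ * (L ^ 2 / M + L * M)) = β * (h₀ ^ 2 / g * L ^ 2) - σ * β * (ar * nA) + σ * β * ((Kr - ar) * nB) +
        β * (C₁ * (L ^ 2 / M + L * M)) := by ring
    linarith [h, e, hcut]
  have bslack : β * ((L ^ 2 - Kr * M ^ 2) * φs) ≤ β * (2 * L * M * |φs|) := mul_le_mul_of_nonneg_left hslack hβ.le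
  have bslack2 : β * (Kr * M ^ 2 * (4 * σ + 3 * r)) ≤ β * (L ^ 2 * (4 * σ + 3 * r)) :=
    mul_le_mul_of_nonneg_left hslack2 hβ.le
  linarith [hZK', pA1, pA2, pB1, pB2, eA, eB, qA, qB, bslack, bslack2, hRle, hE']

/-- **Registered helper stub `stub_twoPhaseGapArithmetic` (S7i-arith; = `tsb_gap_arith` in closed `∀`-form).** [folklore] -/
theorem stub_twoPhaseGapArithmetic : ∀ β L M Kr ar σ r κ C₁ h₀ g μs φs φm1 φm2 φp1 φp2 ZK ZKt ZA ZAm ZB ZBp nA nB XA XB E R Rb : ℝ, (0 < β) → (0 < L) → (0 < M) → (0 ≤ ar) → (ar ≤ Kr) → (Kr * M ^ 2 ≤ L ^ 2) → (L ^ 2 - Kr * M ^ 2 ≤ 2 * L * M) → (0 ≤ r) → (|φs - φm1| ≤ 2 * σ) → (|φm1 - φm2| ≤ 2 * σ) → (|φp1 - φs| ≤ 2 * σ) → (|φp2 - φp1| ≤ 2 * σ) → (ZK / (β * L ^ 2) - (φs - h₀ ^ 2 / g) ≤ κ) → (|ZA / (β * M ^ 2) - φm1| ≤ r) → (|ZAm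 / (β * M ^ 2) - φm2| ≤ r) → (|ZB / (β * M ^ 2) - φp1| ≤ r) → (|ZBp / (β * M ^ 2) - φp2| ≤ r) → (ZA - ZAm ≤ σ * (β * nA)) → (σ * (β * nB) ≤ ZBp - ZB) → (ZKt = ar * ZA + (Kr - ar) * ZB + R) → (|R| ≤ Rb) → (XA = ar * nA) → (XB = (Kr - ar) * nB) → (E ≤ h₀ ^ 2 / g * L ^ 2 + (μs - σ - μs) * XA + (μs + σ - μs) * XB + C₁ * (L ^ 2 / M + L * M)) → ZK - ZKt + β * E ≤ β * (L ^ 2 * (4 * σ + κ + 3 * r + C₁ / M) + L * M * (2 * |φs| + C₁)) + Rb :=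
  @tsb_gap_arith

/-- **Block densities bracket the target.** From the `r`-accuracy of the block pressures at `μs, μs ∓ σ`, the chords of the convex
block `log Z` and the subgradient `1 − δ` of `φ` at `μs`: `nA ≤ nB`, `nA ≤ M²(1 − δ) + 2rM²/σ`, `nB ≥ M²(1 − δ) − 2rM²/σ`. [folklore] -/
theorem tsb_block_arith {β M σ r δ μs φs φm1 φp1 ZS ZA ZB nA nS nB : ℝ} (hβ : 0 < β) (hM : 0 < M) (hσ : 0 < σ)
    (hZS : |ZS / (β * M ^ 2) - φs| ≤ r) (hZA : |ZA / (β * M ^ 2) - φm1| ≤ r) (hZB : |ZB / (β * M ^ 2) - φp1| ≤ r)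
    (c2 : σ * (β * nA) ≤ ZS - ZA) (c3 : ZS - ZA ≤ σ * (β * nS)) (c4 : σ * (β * nS) ≤ ZB - ZS) (c5 : ZB - ZS ≤ σ * (β * nB))
    (hsubm : φs + (1 - δ) * (μs - σ - μs) ≤ φm1) (hsubp : φs + (1 - δ) * (μs + σ - μs) ≤ φp1) :
    nA ≤ nB ∧ nA ≤ M ^ 2 * (1 - δ) + 2 * r * M ^ 2 / σ ∧ M ^ 2 * (1 - δ) - 2 * r * M ^ 2 / σ ≤ nB := by
  have hβM : 0 < β * M ^ 2 := by positivity
  have hσβ : 0 < σ * β := mul_pos hσ hβ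
  have hZS' := abs_le.mp hZS
  have hZA' := abs_le.mp hZA
  have hZB' := abs_le.mp hZB
  have uS : ZS ≤ β * M ^ 2 * (φs + r) := by
    have := (div_le_iff₀ hβM).mp (show ZS / (β * M ^ 2) ≤ φs + r by linarith [hZS'.2]); linarith
  have lS : β * M ^ 2 * (φs - r) ≤ ZS := by
    have := (le_div_iff₀ hβM).mp (show φs - r ≤ ZS / (β * M ^ 2) by linarith [hZS'.1]); linarith
  have lA : β * M ^ 2 * (φm1 - r) ≤ ZA := by
    have := (le_div_iff₀ hβM).mp (show φm1 - r ≤ ZA / (β * M ^ 2) by linarith [hZA'.1]); linarith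
  have uB' : β * M ^ 2 * (φp1 - r) ≤ ZB := by
    have := (le_div_iff₀ hβM).mp (show φp1 - r ≤ ZB / (β * M ^ 2) by linarith [hZB'.1]); linarith
  refine ⟨?_, ?_, ?_⟩
  · have h : σ * (β * nA) ≤ σ * (β * nB) := by linarith
    have h' : (σ * β) * nA ≤ (σ * β) * nB := by
      have e1 : σ * (β * nA) = (σ * β) * nA := by ring
      have e2 : σ * (β * nB) = (σ * β) * nB := by ring
      linarith
    exact le_of_mul_le_mul_left h' hσβ
  · -- σ β nA ≤ ZS − ZA ≤ βM²(φs − φm1 + 2r) ≤ βM²((1−δ)σ + 2r)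
    have h : σ * (β * nA) ≤ β * M ^ 2 * ((1 - δ) * σ + 2 * r) := by nlinarith [c2, uS, lA, hsubm, hβM]
    have : (σ * β) * nA ≤ (σ * β) * (M ^ 2 * (1 - δ) + 2 * r * M ^ 2 / σ) := by
      have e : (σ * β) * (M ^ 2 * (1 - δ) + 2 * r * M ^ 2 / σ) = β * M ^ 2 * ((1 - δ) * σ + 2 * r) := by
        field_simp
      rw [e]; linarith
    exact le_of_mul_le_mul_left this hσβ
  · have h : β * M ^ 2 * ((1 - δ) * σ - 2 * r) ≤ σ * (β * nB) := by nlinarith [c5, lS, uB', hsubp, hβM]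
    have : (σ * β) * (M ^ 2 * (1 - δ) - 2 * r * M ^ 2 / σ) ≤ (σ * β) * nB := by
      have e : (σ * β) * (M ^ 2 * (1 - δ) - 2 * r * M ^ 2 / σ) = β * M ^ 2 * ((1 - δ) * σ - 2 * r) := by
        field_simp
      rw [e]; linarith
    exact le_of_mul_le_mul_left this hσβ

/-- **Mean arithmetic.** With the block densities bracketing `M²(1 − δ)` up to `2rM²/σ`, the tuned block count of `tsb_tuning`, the
remainder number `ρ ∈ [0, 6LM]`, `K M² ≤ L² ≤ K M² + 2LM` and `(1 − δ)L² − 2 ≤ N_L ≤ (1 − δ)L²`: the trial mean is within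
`(4r/σ)L² + 2M² + 8LM + 2` of `N_L`. [folklore] -/
theorem tsb_mean_arith {L M Kr ar σ r δ nA nB ρ NL X : ℝ} (hL : 0 ≤ L) (hM : 0 ≤ M) (hσ : 0 < σ) (hr : 0 ≤ r)
    (hδ0 : 0 ≤ 1 - δ) (hδ1 : 1 - δ ≤ 1) (hKr : 0 ≤ Kr) (hKM : Kr * M ^ 2 ≤ L ^ 2) (hLK : L ^ 2 - Kr * M ^ 2 ≤ 2 * L * M)
    (hnA0 : 0 ≤ nA) (hnB2 : nB ≤ 2 * M ^ 2)
    (hnA : nA ≤ M ^ 2 * (1 - δ) + 2 * r * M ^ 2 / σ) (hnB : M ^ 2 * (1 - δ) - 2 * r * M ^ 2 / σ ≤ nB)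
    (hNL1 : (1 - δ) * L ^ 2 - 2 ≤ NL) (hNL2 : NL ≤ (1 - δ) * L ^ 2) (hρ0 : 0 ≤ ρ) (hρ : ρ ≤ 6 * L * M)
    (htune : |ar * nA + (Kr - ar) * nB - (NL - 3 * L * M)| ≤
      (nB - nA) + max (Kr * nA - (NL - 3 * L * M)) 0 + max ((NL - 3 * L * M) - Kr * nB) 0)
    (hX : X = ar * nA + (Kr - ar) * nB + ρ) :
    |X - NL| ≤ 4 * r / σ * L ^ 2 + 2 * M ^ 2 + 8 * L * M + 2 := by
  have hrs : 0 ≤ 2 * r / σ := by positivity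
  have hKM2 : 0 ≤ Kr * M ^ 2 := by positivity
  have hm1 : max (Kr * nA - (NL - 3 * L * M)) 0 ≤ 2 * r / σ * L ^ 2 + 3 * L * M + 2 := by
    refine max_le ?_ (by positivity)
    have h1 : Kr * nA ≤ Kr * (M ^ 2 * (1 - δ) + 2 * r * M ^ 2 / σ) := mul_le_mul_of_nonneg_left hnA hKr
    have h2 : Kr * (M ^ 2 * (1 - δ) + 2 * r * M ^ 2 / σ) = (1 - δ) * (Kr * M ^ 2) + 2 * r / σ * (Kr * M ^ 2) := by
      field_simp
    have h3 : (1 - δ) * (Kr * M ^ 2) ≤ (1 - δ) * L ^ 2 := mul_le_mul_of_nonneg_left hKM hδ0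
    have h4 : 2 * r / σ * (Kr * M ^ 2) ≤ 2 * r / σ * L ^ 2 := mul_le_mul_of_nonneg_left hKM hrs
    nlinarith [h1, h2, h3, h4, hNL1, hL, hM]
  have hm2 : max ((NL - 3 * L * M) - Kr * nB) 0 ≤ 2 * r / σ * L ^ 2 + 2 * L * M := by
    refine max_le ?_ (by positivity)
    have h1 : Kr * (M ^ 2 * (1 - δ) - 2 * r * M ^ 2 / σ) ≤ Kr * nB := mul_le_mul_of_nonneg_left hnB hKr
    have h2 : Kr * (M ^ 2 * (1 - δ) - 2 * r * M ^ 2 / σ) = (1 - δ) * (Kr * M ^ 2) - 2 * r / σ * (Kr * M ^ 2) := by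
      field_simp
    have h3 : (1 - δ) * (L ^ 2 - Kr * M ^ 2) ≤ 1 * (2 * L * M) :=
      mul_le_mul hδ1 hLK (by linarith) zero_le_one
    have h4 : 2 * r / σ * (Kr * M ^ 2) ≤ 2 * r / σ * L ^ 2 := mul_le_mul_of_nonneg_left hKM hrs
    nlinarith [h1, h2, h3, h4, hNL2, hL, hM]
  have hd : nB - nA ≤ 2 * M ^ 2 := by linarith
  have ht : |ar * nA + (Kr - ar) * nB - (NL - 3 * L * M)| ≤ 4 * r / σ * L ^ 2 + 2 * M ^ 2 + 5 * L * M + 2 := by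
    have e : 4 * r / σ * L ^ 2 = 2 * r / σ * L ^ 2 + 2 * r / σ * L ^ 2 := by ring
    linarith [htune, hm1, hm2, hd]
  have hρ' : |ρ - 3 * L * M| ≤ 3 * L * M := by rw [abs_le]; constructor <;> linarith
  have e : X - NL = (ar * nA + (Kr - ar) * nB - (NL - 3 * L * M)) + (ρ - 3 * L * M) := by rw [hX]; ring
  rw [e]
  exact (abs_add_le _ _).trans (by linarith)


/-- **Remainder number: `0 ≤ Re⟨N_S⟩ ≤ #S`** for `N_S = diag(s ↦ #(s ∩ S))` in the Gibbs state of a Hermitian Hamiltonian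
(`N_S` and `#S·1 − N_S` are diagonal with non-negative entries; the state is positive and normalised). [folklore] -/
theorem tsb_re_gibbsState_numberDiag_bounds {ι : Type*} [DecidableEq ι] [Fintype ι]
    {H : Matrix (Finset ι) (Finset ι) ℂ} (hH : H.IsHermitian) (β : ℝ) (S : Finset ι) :
    0 ≤ (gibbsState β H (diagonal fun s : Finset ι => (((s ∩ S).card : ℕ) : ℂ))).re ∧
      (gibbsState β H (diagonal fun s : Finset ι => (((s ∩ S).card : ℕ) : ℂ))).re ≤ S.card := by
  have hZ : partitionFn β H ≠ 0 := by
    rw [partitionFn_eq_re hH β, Ne, Complex.ofReal_eq_zero]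
    exact (partitionFn_re_pos hH β).ne'
  constructor
  · have hpsd : (diagonal fun s : Finset ι => (((s ∩ S).card : ℕ) : ℂ)).PosSemidef := by
      refine posSemidef_diagonal_iff.mpr fun s => ?_
      exact_mod_cast Nat.zero_le _
    exact (Complex.nonneg_iff.mp (gibbsState_nonneg_of_posSemidef β hH hpsd)).1
  · have hdiff : ((S.card : ℝ) : ℂ) • (1 : Matrix (Finset ι) (Finset ι) ℂ) -
        (diagonal fun s : Finset ι => (((s ∩ S).card : ℕ) : ℂ)) =
        diagonal fun s : Finset ι => (((S.card : ℝ) - ((s ∩ S).card : ℝ) : ℝ) : ℂ) := by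
      rw [smul_one_eq_diagonal, diagonal_sub]
      congr 1
      funext s
      push_cast
      ring
    have hpsd : (((S.card : ℝ) : ℂ) • (1 : Matrix (Finset ι) (Finset ι) ℂ) -
        (diagonal fun s : Finset ι => (((s ∩ S).card : ℕ) : ℂ))).PosSemidef := by
      rw [hdiff]
      refine posSemidef_diagonal_iff.mpr fun s => ?_
      rw [Complex.zero_le_real, sub_nonneg]
      exact_mod_cast Finset.card_le_card Finset.inter_subset_right
    have h0 := (Complex.nonneg_iff.mp (gibbsState_nonneg_of_posSemidef β hH hpsd)).1
    rw [map_sub, map_smul, gibbsState_one β H hZ, smul_eq_mul, mul_one, Complex.sub_re, Complex.ofReal_re] at h0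
    linarith

/-- **Gap, finally.** The raw gap bound of `tsb_gap_arith` is `≤ βεL²` once `4σ, κ, 3r, C₁/M ≤ ε/64·(4,1,3,1)` and
`L` is large enough for the `O(LM)` terms. [folklore] -/
theorem tsb_gap_final {A β L M σ r κ C₁ c₃ Rb c₄ ε : ℝ} (hβ : 0 < β) (hL : 0 ≤ L) (hε : 0 ≤ ε)
    (hA : A ≤ β * (L ^ 2 * (4 * σ + κ + 3 * r + C₁ / M) + L * M * c₃) + Rb)
    (hσ : σ ≤ ε / 64) (hκ : κ ≤ ε / 64) (hr : r ≤ ε / 64) (hcut : C₁ / M ≤ ε / 64)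
    (hRb : Rb ≤ c₄ * L * M) (hthr : M * (β * c₃ + c₄) ≤ β * (ε / 2) * L) :
    A ≤ β * ε * L ^ 2 := by
  have h1 : β * (L * M * c₃) + c₄ * L * M = L * (M * (β * c₃ + c₄)) := by ring
  have h2 : L * (M * (β * c₃ + c₄)) ≤ L * (β * (ε / 2) * L) := mul_le_mul_of_nonneg_left hthr hL
  have h3 : β * (L ^ 2 * (4 * σ + κ + 3 * r + C₁ / M)) ≤ β * (L ^ 2 * (9 * ε / 64)) := by
    refine mul_le_mul_of_nonneg_left (mul_le_mul_of_nonneg_left ?_ (sq_nonneg L)) hβ.le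
    linarith
  nlinarith [h1, h2, h3, hβ, sq_nonneg L, mul_nonneg (mul_nonneg hβ.le hε) (sq_nonneg L)]

/-- **Fluctuation, finally.** `V ≤ 6 E_N² + C₂L²M²` with `E_N = θL² + P`, `θ ≤ ε/8`, `P ≤ 12LM`, `ε ≤ 1` and `L` large is
`≤ εL⁴`. [folklore] -/
theorem tsb_fluct_final {V X NL EN θ P C₂ L M ε : ℝ} (hL : 1 ≤ L) (hε0 : 0 < ε) (hε1 : ε ≤ 1)
    (hV : V ≤ 6 * (X - NL) ^ 2 + C₂ * L ^ 2 * M ^ 2) (hX : |X - NL| ≤ EN) (hEN : EN = θ * L ^ 2 + P)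
    (hθ0 : 0 ≤ θ) (hθ : θ ≤ ε / 8) (hP0 : 0 ≤ P) (hP : P ≤ 12 * L * M)
    (hthr : (1728 + C₂) * M ^ 2 ≤ 13 / 16 * ε * L) : V ≤ ε * L ^ 4 := by
  have hL0 : 0 ≤ L := zero_le_one.trans hL
  have hsq : (X - NL) ^ 2 ≤ EN ^ 2 := by
    have := abs_le.mp hX
    nlinarith [abs_nonneg (X - NL)]
  have hEN2 : EN ^ 2 ≤ 2 * (θ * L ^ 2) ^ 2 + 2 * P ^ 2 := by rw [hEN]; nlinarith [sq_nonneg (θ * L ^ 2 - P)]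
  have hθ2 : (θ * L ^ 2) ^ 2 ≤ (ε / 8) ^ 2 * L ^ 4 := by
    have : (θ * L ^ 2) ^ 2 = θ ^ 2 * L ^ 4 := by ring
    rw [this]
    exact mul_le_mul_of_nonneg_right (pow_le_pow_left₀ hθ0 hθ 2) (by positivity)
  have hP2 : P ^ 2 ≤ 144 * L ^ 2 * M ^ 2 := by nlinarith [hP, hP0]
  have hε2 : (ε / 8) ^ 2 ≤ ε / 64 := by nlinarith
  have hL3 : L ^ 3 ≤ L ^ 4 := pow_le_pow_right₀ hL (by norm_num)
  have hthr' : (1728 + C₂) * M ^ 2 * L ^ 2 ≤ 13 / 16 * ε * L ^ 3 := by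
    have := mul_le_mul_of_nonneg_right hthr (sq_nonneg L)
    nlinarith [this]
  nlinarith [hV, hsq, hEN2, hθ2, hP2, hε2, hL3, hthr', mul_nonneg (mul_nonneg (show (0:ℝ) ≤ 6 by norm_num) (sq_nonneg (ε/8))) (pow_nonneg hL0 4),
    pow_nonneg hL0 4, hε0.le]


end

end Summit.HubbardSuperconductivity.HubbardSuperconductivity.Theorems.TwSeededEnsembleEquivalenceR.ColdFloorLine
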